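import Summits.QuantumFields.YangMills.Theses.ScalingWindowSplit
import Summits.QuantumFields.YangMills.Theorems.NPointIsotropy.Negative.HyperoctahedralPlane

/-!
# `CurvatureAmnesia` — negative side I: the crux unbundled; the model-blind form; the hypothesis `H`;
refutation cost

Standing disprover of crux `stmt-QuantumFields-16192` (`CoincidenceRotationBootstrap.CurvatureAmnesia`,
shared verbatim with `ScalingWindowSplit.CurvatureAmnesia`), cycle 1, file 1/3. Tree objects only.

* `curvatureAmnesia_iff` (definitional): the crux is
  `∀ G …, IsCompactSimpleLieGroup G → ∀ r sch S, sch.HasWeakCouplingLimit → OSBlock S → Tie r sch S →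
   CurvNontrivial S r.curvature → (∃ Δ, 0 < Δ ∧ S.HasMassGap Δ ∧ HasLatticeMassGap r sch Δ) → SigmaFive S r.curvature`;
  the two route copies agree (`curvatureAmnesia_scalingWindowSplit_iff`).
* `CurvatureAmnesiaModelBlind`: the crux with its two LATTICE clauses deleted (the Wilson tie and
  `HasLatticeMassGap`), everything else — `G`, `r`, the weak-coupling scheme, E0, E0h, E0', E2, E3, E4,
  translations, proper signed permutations, non-triviality of the curvature two-point function, the continuum
  gap — kept verbatim; `curvatureAmnesia_of_modelBlind`. It is refuted modulo `H` in file 3/3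
  (`ModelBlindFalse.lean`).
* The hypothesis `H` of that refutation — ONE one-field Schwinger family on `ℝ⁴` with E0–E4 (as typed),
  translation and full isometry invariance on `⁰𝒮`, a mass gap, and a non-trivial truncated two-point function at a
  reflected pair (e.g. the free massive scalar field, Glimm–Jaffe 1987 §6.2, Thm. 6.2.4) — is filed separately as the
  Literature named fact `Literature.MathematicalPhysics.QuantumFieldTheory.IsotropicOSFamilyExists`; file 3/3 takes its
  clauses as explicit hypotheses, so nothing here depends on it.
* `latticeGapWitness_of_not_curvatureAmnesia` (refutation cost, pure logic): a refutation of the crux exhibits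
  a compact simple `G`, a faithful `r` and a scheme AT WEAK COUPLING with a volume-uniform lattice mass gap
  `HasLatticeMassGap r sch Δ`, `Δ > 0` — the open weak-coupling lattice mass-gap problem — so no unconditional
  `¬ CurvatureAmnesia` is available without solving it.
-/

noncomputable section

-- Mathlib's `SimplexCategory` instance `Fintype (Fin (x.len + 1))` matches `Fintype (Fin 4)` and makes concrete
-- `Fin 4` instance paths diverge between elaborations (tree-known workaround, cf. `NPointIsotropy.Negative`).
attribute [-instance] SimplexCategory.instFintypeToTypeOrderHomFinHAddNatLenOfNat

namespace Summit.QuantumFields.YangMills.Theorems.CurvatureAmnesia.Negative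

open scoped BigOperators SchwartzMap ComplexConjugate InnerProductSpace
open MeasureTheory Filter Topology
open Literature.MathematicalPhysics.QuantumLattice Literature.MathematicalPhysics.AQFT
  Literature.MathematicalPhysics.QuantumFieldTheory
open Summit.QuantumFields.YangMills.Theorems.NPointIsotropy.Negative

/-! ## §0 The crux unbundled -/

section Blocks

variable {ι : Type}

/-- The OS block of the crux for a labelled family: E0 (normalisation, hermiticity), E0', E2, E3, E4,
translation invariance on `⁰𝒮`, invariance on `⁰𝒮` under the proper signed permutations. [folklore] -/
def OSBlock (S : LabelledSchwingerFamily ι E4) : Prop :=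
  S.IsNormalized ∧ S.IsHermitian ∧ S.HasLinearGrowth ∧ S.IsReflectionPositive ∧ S.IsSymmetric ∧
    S.HasClusterProperty ∧
    (∀ (n : ℕ) (k : Fin n → ι) (a : E4) (F : 𝓢((Fin n → E4), ℂ)), IsOffDiagonal F →
      S n k (translateMulti a F) = S n k F) ∧
    (∀ (n : ℕ) (k : Fin n → ι) (R : E4 ≃ₗᵢ[ℝ] E4), LinearMap.det (R.toLinearEquiv : E4 →ₗ[ℝ] E4) = 1 →
      (∀ i : Fin 4, ∃ j : Fin 4, R (EuclideanSpace.single i 1) = EuclideanSpace.single j 1 ∨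
        R (EuclideanSpace.single i 1) = -EuclideanSpace.single j 1) →
      ∀ F : 𝓢((Fin n → E4), ℂ), IsOffDiagonal F → S n k (linActMulti R F) = S n k F)

/-- Non-triviality of the truncated two-point function of species `s` at a reflected pair (verbatim the
crux's clause; `OSData.IsNontrivial` unbundled). [folklore] -/
def CurvNontrivial (S : LabelledSchwingerFamily ι E4) (s : ι) : Prop :=
  ∃ (F₁ G₁ : 𝓢((Fin 1 → E4), ℂ)) (H₁ : 𝓢((Fin (1 + 1) → E4), ℂ)),
    IsTimeOrdered F₁ ∧ IsTimeOrdered G₁ ∧ IsAppendTensorOf H₁ (osAdjoint F₁) G₁ ∧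
      S (1 + 1) (fun _ => s) H₁ ≠ S 1 (fun _ => s) (osAdjoint F₁) * S 1 (fun _ => s) G₁

/-- The conclusion of the crux: Σ5-invariance on `⁰𝒮` of the species-`s` Schwinger functions, every arity,
for every isometry acting on the axes as the rotation `cos θ = 3/5` of the `(x₂,x₃)`-plane. [folklore] -/
def SigmaFive (S : LabelledSchwingerFamily ι E4) (s : ι) : Prop :=
  ∀ (R : E4 ≃ₗᵢ[ℝ] E4),
    (R (EuclideanSpace.single 0 1) = EuclideanSpace.single 0 1 ∧
      R (EuclideanSpace.single 1 1) = EuclideanSpace.single 1 1 ∧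
      R (EuclideanSpace.single 2 1) = (3/5 : ℝ) • EuclideanSpace.single 2 1 + (4/5 : ℝ) • EuclideanSpace.single 3 1 ∧
      R (EuclideanSpace.single 3 1) = -((4/5 : ℝ) • EuclideanSpace.single 2 1) + (3/5 : ℝ) • EuclideanSpace.single 3 1) →
    ∀ (n : ℕ) (F : 𝓢((Fin n → E4), ℂ)), IsOffDiagonal F → S n (fun _ => s) (linActMulti R F) = S n (fun _ => s) F

variable {G : Type} [Group G] [TopologicalSpace G] [IsTopologicalGroup G] [CompactSpace G]
  [MeasurableSpace G] [BorelSpace G]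

/-- The Wilson TIE of the crux (the body of `IsYangMillsFor`): along `sch`, every renormalised lattice string
converges to `S` on off-diagonal real tensors. [folklore] -/
def Tie (r : LatticeRep G) (sch : SpeciesScheme (YMSpecies G)) (S : LabelledSchwingerFamily (YMSpecies G) E4) :
    Prop :=
  ∀ (n : ℕ), n ≠ 0 → ∀ (σ : Fin n → YMSpecies G) (f : Fin n → 𝓢(E4, ℝ)) (F : 𝓢((Fin n → E4), ℂ)),
    IsTensorOf F (fun i => ofRealTest (f i)) → IsOffDiagonal F →
      Tendsto (fun k : ℕ => ((latticeSchwinger r.ρ sch (fun s => s.F) k n σ f : ℝ) : ℂ)) atTop (𝓝 (S n σ F))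

end Blocks

/-- **§0a. The crux, unbundled** (definitional). [folklore] -/
theorem curvatureAmnesia_iff :
    Summit.QuantumFields.YangMills.Theses.CoincidenceRotationBootstrap.CurvatureAmnesia ↔
      ∀ (G : Type) [Group G] [TopologicalSpace G] [IsTopologicalGroup G] [CompactSpace G],
        IsCompactSimpleLieGroup G →
        letI : MeasurableSpace G := borel G
        haveI : BorelSpace G := ⟨rfl⟩
        ∀ (r : LatticeRep G) (sch : SpeciesScheme (YMSpecies G)) (S : LabelledSchwingerFamily (YMSpecies G) E4),
          sch.HasWeakCouplingLimit → OSBlock S → Tie r sch S → CurvNontrivial S r.curvature →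
            (∃ Δ : ℝ, 0 < Δ ∧ S.HasMassGap Δ ∧ HasLatticeMassGap r sch Δ) → SigmaFive S r.curvature :=
  Iff.rfl

/-- The two route copies of the crux are the same proposition. [folklore] -/
theorem curvatureAmnesia_scalingWindowSplit_iff :
    Summit.QuantumFields.YangMills.Theses.ScalingWindowSplit.CurvatureAmnesia ↔
      Summit.QuantumFields.YangMills.Theses.CoincidenceRotationBootstrap.CurvatureAmnesia :=
  Iff.rfl

/-! ## §1 The model-blind form -/

/-- **The crux without its two lattice clauses** (the Wilson tie and `HasLatticeMassGap`), everything else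
verbatim: `G`, `r`, the weak-coupling scheme, the OS block, non-triviality and the continuum gap. -/
def CurvatureAmnesiaModelBlind : Prop :=
  ∀ (G : Type) [Group G] [TopologicalSpace G] [IsTopologicalGroup G] [CompactSpace G],
    IsCompactSimpleLieGroup G →
    letI : MeasurableSpace G := borel G
    haveI : BorelSpace G := ⟨rfl⟩
    ∀ (r : LatticeRep G) (sch : SpeciesScheme (YMSpecies G)) (S : LabelledSchwingerFamily (YMSpecies G) E4),
      sch.HasWeakCouplingLimit → OSBlock S → CurvNontrivial S r.curvature →
        (∃ Δ : ℝ, 0 < Δ ∧ S.HasMassGap Δ) → SigmaFive S r.curvature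

/-- **§1a.** The model-blind form implies the crux (forget the tie and the lattice gap): a proof of the crux
that never reads the lattice is a proof of `CurvatureAmnesiaModelBlind`. [folklore] -/
theorem curvatureAmnesia_of_modelBlind (h : CurvatureAmnesiaModelBlind) :
    Summit.QuantumFields.YangMills.Theses.CoincidenceRotationBootstrap.CurvatureAmnesia := by
  rw [curvatureAmnesia_iff]
  intro G _ _ _ _ hG r sch S hw hOS _ hN hgap
  obtain ⟨Δ, hΔ, hS, -⟩ := hgap
  exact h G hG r sch S hw hOS hN ⟨Δ, hΔ, hS⟩

/-! ## §2 Refutation cost: `¬ CurvatureAmnesia` exhibits a weak-coupling uniformly gapped Wilson scheme -/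

/-- **Refutation cost (pure logic).** Any refutation of the crux produces a compact simple `G`, a faithful
`r` and a scheme with `β_k → ∞` carrying a volume-uniform lattice mass gap `Δ > 0` (and a tied, non-trivial,
gapped OS family violating Σ5): in particular a solution of the weak-coupling lattice mass-gap problem for
some compact simple gauge group. This is why the standing disprover files no unconditional `¬ CurvatureAmnesia`.
[folklore] -/
theorem latticeGapWitness_of_not_curvatureAmnesia
    (h : ¬ Summit.QuantumFields.YangMills.Theses.CoincidenceRotationBootstrap.CurvatureAmnesia) :
    ∃ (G : Type) (_ : Group G) (_ : TopologicalSpace G) (_ : IsTopologicalGroup G) (_ : CompactSpace G)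
      (_ : MeasurableSpace G) (_ : BorelSpace G),
      IsCompactSimpleLieGroup G ∧
      ∃ (r : LatticeRep G) (sch : SpeciesScheme (YMSpecies G)) (S : LabelledSchwingerFamily (YMSpecies G) E4)
        (Δ : ℝ), sch.HasWeakCouplingLimit ∧ 0 < Δ ∧ HasLatticeMassGap r sch Δ ∧ Tie r sch S ∧
          CurvNontrivial S r.curvature ∧ S.HasMassGap Δ ∧ OSBlock S ∧ ¬ SigmaFive S r.curvature := by
  by_contra hc
  apply h
  rw [curvatureAmnesia_iff]
  intro G _ _ _ _ hG r sch S hw hOS hT hN hgap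
  obtain ⟨Δ, hΔ, hS, hL⟩ := hgap
  by_contra hS5
  letI : MeasurableSpace G := borel G
  haveI : BorelSpace G := ⟨rfl⟩
  exact hc ⟨G, _, _, _, _, inferInstance, inferInstance, hG, r, sch, S, Δ, hw, hΔ, hL, hT, hN, hS, hOS, hS5⟩

end Summit.QuantumFields.YangMills.Theorems.CurvatureAmnesia.Negative

end
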